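import Literature.NumberTheory.EllipticCurves.Wuthrich2014.ThreeAdicImageSupersingularProofs
import HarnessLib

/-!
# Kato 2004, condition (12.5.2) at every ODD SEMISTABLE prime is the census bit `surj(p)`:
# `p ≠ 2`, `E` good or multiplicative at `p`, `ρ̄_{E,p}` onto ⟹ `ρ̄_{E,pⁿ}` onto for all `n`
# ⟹ the image of `Gal(ℚ̄/ℚ(ζ_{p^∞}))` in `Aut(T_pE)` contains `SL₂(ℤ_p)`

`Proofs` file (theorems only: no definition, no named fact, debt 0), topic
`NumberTheory/EllipticCurves`, sibling of `Kato2004/Condition1252.lean` (the predicate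
`Kato2004.ImageContainsSL2 W p` = K. Kato, *p-adic Hodge theory and values of zeta functions of
modular forms*, Astérisque 295 (2004), condition (12.5.2) in Thm. 12.5 (4), p. 222: "the image of
`Gal(ℚ̄/ℚ(ζ_{p^∞}))` in `GL_{O_λ}(T)` contains `SL_{ℤ_p}(T)`" — the integrality hypothesis of Thms.
12.5 (4), 13.4 (3), 14.5 (3) and 17.4 (3); PROVED there equivalent to `∀ n, ρ̄_{E,pⁿ}` onto,
`Kato2004.imageContainsSL2_iff_forall_hasSurjectiveModNGaloisRep`).

## What this file records (unit `b2b-bsdres-lit-kato` gen 9; a RESTORATION)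

The uniform statements below were part of the unit's gen-8 landing p251008 on the path
`Wuthrich2014/ThreeAdicImageSupersingularProofs.lean` (accepted 2026-08-21T05:48Z) and were lost
when that path was replaced by the independently written file of team n1011 seat p02 (p250793,
accepted 05:56Z; same target theorem `Wuthrich2014.lemma20_surjective_threeAdic_of_semistable_holds`,
which survives).  They are re-derived here, in a file of their own, from:

* `p = 3`: Wuthrich 2014 Lemma 20 AS A THEOREM —
  `Wuthrich2014.lemma20_surjective_threeAdic_of_semistable_holds` (C. Wuthrich, Doc. Math. 19
  (2014), Lemma 20, p. 399: "Let `p = 3` and suppose `p²` does not divide the conductor `N`. If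
  `ρ̄` is surjective then `ρ : Gal(ℚ̄/ℚ) → GL₂(ℤ_p)` is surjective, too"; proved in the tree by a
  local argument at `3`: inertia words in the good-ordinary / multiplicative cases, wild
  ramification of the `9`-torsion of the height-`2` formal group in the good-supersingular case);
* `p ≥ 5`: Serre's lifting lemma — `serre_hasSurjectiveModNGaloisRep_pow_holds` (J.-P. Serre,
  *Abelian ℓ-adic representations and elliptic curves* (1968), IV-23 Lemma 3: a closed subgroup of
  `SL₂(ℤ_p)` mapping onto `SL₂(𝔽_p)` is `SL₂(ℤ_p)` when `p ≥ 5`), which needs no reduction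
  hypothesis at all.

Results (every Weierstrass model, no minimality hypothesis):

* `WeierstrassCurve.forall_hasSurjectiveModNGaloisRep_pow_of_semistable_of_surj` — `p ≠ 2`, `E`
  good or multiplicative at `p`, `ρ̄_{E,p}` onto ⟹ `ρ̄_{E,pⁿ}` onto for every `n`;
* `WeierstrassCurve.forall_hasSurjectiveModNGaloisRep_pow_of_surj_of_five_le_or_semistable` — the
  same under `5 ≤ p ∨ good ∨ multiplicative`;
* `WeierstrassCurve.forall_hasSurjectiveModNGaloisRep_pow_of_goodSupersingular_of_surj` — the
  gen-8 name for the good-supersingular special case (announced to the Gss∣I₀* consumers), now a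
  one-line corollary;
* `Kato2004.imageContainsSL2_of_semistable_of_surj`,
  `Kato2004.imageContainsSL2_iff_hasSurjectiveModNGaloisRep_of_semistable` (and the
  `…five_le_or_semistable` forms): **at every odd prime of semistable reduction Kato's (12.5.2)
  for `T_pE` is EQUIVALENT to the surjectivity of `ρ̄_{E,p}`** — so the integral clause of every
  Kato statement in the tree (`kato_divisibility` (3), the `Kato2004/BigImage…` component
  readings, Thm. 14.5 (3) readings) carries, at such `p`, exactly the census bit `surj(p)` of the
  cell `bsd-rank1-residual`; only at `p = 2` and at ADDITIVE `3` is (12.5.2) a condition beyond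
  `surj(p)` (there: a semistable quadratic twist, a `j`-witness, `surj(9)`, or a Frobenius
  certificate — `Kato2004/Condition1252.lean`, `Kato2004/ThreeAdicFrobeniusCertificate.lean`).

HONEST FRAMING (cell `b2b-bsdres`): bookkeeping precision on the Kato side; no residual class of the
rank-≤ 1 census changes label; nothing is booked by this file.

## References

* [Kato2004Asterisque] K. Kato, Astérisque 295 (2004), (12.5.2) p. 222; Thm. 17.4 (3) p. 273;
  Remark after (12.8.1) p. 223 ("these conditions are satisfied for almost all λ").
* [Wuthrich2014] C. Wuthrich, Doc. Math. 19 (2014) 381–402, Lemma 20 (p. 399).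
* [SerreAbelianLadic1968] J.-P. Serre, *Abelian ℓ-adic representations and elliptic curves*,
  Ch. IV §3.4, Lemma 3 (IV-23).
* [Serre1972] J.-P. Serre, Invent. Math. 15 (1972), §1.11 Prop. 12 (the good-supersingular input).
-/

noncomputable section

open scoped Classical

namespace WeierstrassCurve

open Literature.NumberTheory.EllipticCurves

variable (W : WeierstrassCurve ℚ) [W.IsElliptic] (p : ℕ) [Fact p.Prime]

/-- An odd prime other than `3` is at least `5`. [folklore] -/
private theorem five_le_of_prime_of_ne {p : ℕ} (hp : p.Prime) (hp2 : p ≠ 2) (hp3 : p ≠ 3) :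
    5 ≤ p := by
  by_contra hlt
  have h4 : p = 4 := by have := hp.two_le; omega
  exact absurd hp (by rw [h4]; decide)

/-- **The `p`-adic tower at an odd SEMISTABLE prime from `surj(p)` alone** (any Weierstrass model):
for an elliptic curve `E = W/ℚ`, an odd prime `p` at which `E` has good or multiplicative
reduction, and `ρ̄_{E,p}` onto `Aut(E[p])`, the representation `ρ̄_{E,pⁿ}` is onto for every `n`
(`ρ_{E,p^∞}(Γ_ℚ) = GL₂(ℤ_p)`).  At `p = 3` this is Wuthrich 2014 Lemma 20, a tree THEOREM
(`Wuthrich2014.lemma20_surjective_threeAdic_of_semistable_holds`); at `p ≥ 5` it is Serre's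
lifting lemma (`serre_hasSurjectiveModNGaloisRep_pow_holds`, no reduction hypothesis).
[cite: Wuthrich2014, Lemma 20 (p. 399)] [cite: SerreAbelianLadic1968, Ch. IV §3.4, Lemma 3 (IV-23)] -/
theorem forall_hasSurjectiveModNGaloisRep_pow_of_semistable_of_surj (hp2 : p ≠ 2)
    (hred : W.HasGoodReductionAtPrime p ∨ W.HasMultiplicativeReductionAtPrime p)
    (hsurj : W.HasSurjectiveModNGaloisRep p) (n : ℕ) :
    W.HasSurjectiveModNGaloisRep (p ^ n : ℕ) := by
  have hp : p.Prime := Fact.out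
  by_cases hp3 : p = 3
  · subst hp3
    exact Wuthrich2014.lemma20_surjective_threeAdic_of_semistable_holds W hred hsurj n
  · exact serre_hasSurjectiveModNGaloisRep_pow_holds W p (five_le_of_prime_of_ne hp hp2 hp3) hsurj n

/-- **The tower at an odd good SUPERSINGULAR prime from `surj(p)`** (restored gen-8 name; globally
minimal model, `p ≠ 2`, good reduction with `p ∣ a_p`, `ρ̄_{E,p}` onto ⟹ `ρ̄_{E,pⁿ}` onto for all
`n`).  A special case of `forall_hasSurjectiveModNGaloisRep_pow_of_semistable_of_surj` (the
minimality and supersingularity hypotheses are not needed); kept under this name because it was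
announced to consumers (cell `bsd-rank1-residual`, rows Gss∣I₀* of X4 at `3`, where it is applied to
the good-supersingular twist `E♭`).  At `p = 3` the content is
`WeierstrassCurve.forall_hasSurjectiveModNGaloisRep_three_pow_of_goodSupersingular_of_surj`
(wild ramification of `E[9]`, Serre 1972 §1.11 Prop. 12); at `p ≥ 5` Serre's lifting lemma.
[cite: Serre1972, §1.11 Prop. 12] [cite: SerreAbelianLadic1968, Ch. IV §3.4, Lemma 3 (IV-23)]
[cite: Wuthrich2014, Lemma 20 (p. 399)] -/
theorem forall_hasSurjectiveModNGaloisRep_pow_of_goodSupersingular_of_surj [W.IsGloballyMinimal]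
    (hp2 : p ≠ 2) (hgood : W.HasGoodReductionAtPrime p) (_hss : (p : ℤ) ∣ W.frobeniusTrace p)
    (hsurj : W.HasSurjectiveModNGaloisRep p) (n : ℕ) :
    W.HasSurjectiveModNGaloisRep (p ^ n : ℕ) :=
  W.forall_hasSurjectiveModNGaloisRep_pow_of_semistable_of_surj p hp2 (Or.inl hgood) hsurj n

/-- **The tower from `surj(p)` at an odd prime which is `≥ 5` or semistable for `E`** (any model):
`p ≠ 2`, (`5 ≤ p` or `E` good or multiplicative at `p`), `ρ̄_{E,p}` onto ⟹ `ρ̄_{E,pⁿ}` onto for all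
`n`.  The only odd prime left out is an ADDITIVE `3` (where the conclusion can fail: Elkies'
`3`-adic images, `Kato2004/Condition1252.lean`).
[cite: SerreAbelianLadic1968, Ch. IV §3.4, Lemma 3 (IV-23)] [cite: Wuthrich2014, Lemma 20 (p. 399)] -/
theorem forall_hasSurjectiveModNGaloisRep_pow_of_surj_of_five_le_or_semistable (hp2 : p ≠ 2)
    (h : 5 ≤ p ∨ W.HasGoodReductionAtPrime p ∨ W.HasMultiplicativeReductionAtPrime p)
    (hsurj : W.HasSurjectiveModNGaloisRep p) (n : ℕ) :
    W.HasSurjectiveModNGaloisRep (p ^ n : ℕ) := by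
  rcases h with h5 | hred
  · exact serre_hasSurjectiveModNGaloisRep_pow_holds W p h5 hsurj n
  · exact W.forall_hasSurjectiveModNGaloisRep_pow_of_semistable_of_surj p hp2 hred hsurj n

end WeierstrassCurve

namespace Literature.NumberTheory.EllipticCurves

namespace Kato2004

open WeierstrassCurve

variable (W : WeierstrassCurve ℚ) [W.IsElliptic] (p : ℕ) [Fact p.Prime]

/-- **Kato's (12.5.2) at an odd SEMISTABLE prime from the census bit `surj(p)`**: for `E = W/ℚ`
(any model), `p ≠ 2` good or multiplicative for `E`, and `ρ̄_{E,p}` onto, the image of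
`Gal(ℚ̄/ℚ(ζ_{p^∞}))` in `Aut_{ℤ_p}(T_pE)` contains `SL₂(ℤ_p)` — the integrality hypothesis of
Kato's Thms. 12.5 (4) / 13.4 (3) / 14.5 (3) / 17.4 (3) holds.
[cite: Kato2004Asterisque, (12.5.2) in Thm. 12.5 (4) (p. 222); Thm. 17.4 (3) (p. 273)]
[cite: Wuthrich2014, Lemma 20 (p. 399)] [cite: SerreAbelianLadic1968, Ch. IV §3.4, Lemma 3 (IV-23)] -/
theorem imageContainsSL2_of_semistable_of_surj (hp2 : p ≠ 2)
    (hred : W.HasGoodReductionAtPrime p ∨ W.HasMultiplicativeReductionAtPrime p)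
    (hsurj : W.HasSurjectiveModNGaloisRep p) : ImageContainsSL2 W p :=
  imageContainsSL2_of_forall_hasSurjectiveModNGaloisRep W p
    (W.forall_hasSurjectiveModNGaloisRep_pow_of_semistable_of_surj p hp2 hred hsurj)

/-- **At an odd semistable prime, Kato's (12.5.2) for `T_pE` ⟺ `ρ̄_{E,p}` onto.**  (⟹ is level
`n = 1` of `Kato2004.forall_hasSurjectiveModNGaloisRep_of_imageContainsSL2`, any `p`.)  So on the
whole odd semistable locus the hypothesis separating Kato's INTEGRAL clause 17.4 (3) from the
RATIONAL clause 17.4 (2) is decided by the mod-`p` image alone; Kato, p. 223: "By [Se2, Ribet],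
these conditions are satisfied for almost all λ".
[cite: Kato2004Asterisque, (12.5.2) in Thm. 12.5 (4) (p. 222); Remark 12.8 (p. 223)]
[cite: Wuthrich2014, Lemma 20 (p. 399)] [cite: SerreAbelianLadic1968, Ch. IV §3.4, Lemma 3 (IV-23)] -/
theorem imageContainsSL2_iff_hasSurjectiveModNGaloisRep_of_semistable (hp2 : p ≠ 2)
    (hred : W.HasGoodReductionAtPrime p ∨ W.HasMultiplicativeReductionAtPrime p) :
    ImageContainsSL2 W p ↔ W.HasSurjectiveModNGaloisRep p :=
  ⟨hasSurjectiveModNGaloisRep_of_imageContainsSL2 W p,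
    imageContainsSL2_of_semistable_of_surj W p hp2 hred⟩

/-- **Kato's (12.5.2) from `surj(p)` at every odd prime which is `≥ 5` or semistable for `E`.**
[cite: Kato2004Asterisque, (12.5.2) in Thm. 12.5 (4) (p. 222)]
[cite: SerreAbelianLadic1968, Ch. IV §3.4, Lemma 3 (IV-23)] [cite: Wuthrich2014, Lemma 20 (p. 399)] -/
theorem imageContainsSL2_of_surj_of_five_le_or_semistable (hp2 : p ≠ 2)
    (h : 5 ≤ p ∨ W.HasGoodReductionAtPrime p ∨ W.HasMultiplicativeReductionAtPrime p)
    (hsurj : W.HasSurjectiveModNGaloisRep p) : ImageContainsSL2 W p :=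
  imageContainsSL2_of_forall_hasSurjectiveModNGaloisRep W p
    (W.forall_hasSurjectiveModNGaloisRep_pow_of_surj_of_five_le_or_semistable p hp2 h hsurj)

/-- **(12.5.2) ⟺ `surj(p)` at every odd prime which is `≥ 5` or semistable for `E`** — i.e. at every
odd prime except an additive `3`. [cite: Kato2004Asterisque, (12.5.2) in Thm. 12.5 (4) (p. 222)]
[cite: SerreAbelianLadic1968, Ch. IV §3.4, Lemma 3 (IV-23)] [cite: Wuthrich2014, Lemma 20 (p. 399)] -/
theorem imageContainsSL2_iff_hasSurjectiveModNGaloisRep_of_five_le_or_semistable (hp2 : p ≠ 2)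
    (h : 5 ≤ p ∨ W.HasGoodReductionAtPrime p ∨ W.HasMultiplicativeReductionAtPrime p) :
    ImageContainsSL2 W p ↔ W.HasSurjectiveModNGaloisRep p :=
  ⟨hasSurjectiveModNGaloisRep_of_imageContainsSL2 W p,
    imageContainsSL2_of_surj_of_five_le_or_semistable W p hp2 h⟩

/-- **Contrapositive, for the census**: at an odd prime `p` which is `≥ 5` or semistable for `E`,
if (12.5.2) FAILS then already `ρ̄_{E,p}` is not onto — the pair lies in the "small image" classes
(X9 / X10b / X11-non-surjective of the rank-≤ 1 census), never in a surjective class.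
[cite: Kato2004Asterisque, (12.5.2) in Thm. 12.5 (4) (p. 222); Thm. 17.4 (2)(3) (p. 273)] -/
theorem not_hasSurjectiveModNGaloisRep_of_not_imageContainsSL2_of_five_le_or_semistable
    (hp2 : p ≠ 2)
    (h : 5 ≤ p ∨ W.HasGoodReductionAtPrime p ∨ W.HasMultiplicativeReductionAtPrime p)
    (hnot : ¬ ImageContainsSL2 W p) : ¬ W.HasSurjectiveModNGaloisRep p :=
  fun hsurj ↦ hnot (imageContainsSL2_of_surj_of_five_le_or_semistable W p hp2 h hsurj)

end Kato2004

end Literature.NumberTheory.EllipticCurves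

end
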